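import Literature.NumberTheory.EllipticCurves.ZpExtensionEisensteinDVRSetting
import Literature.NumberTheory.EllipticCurves.ZpExtensionEisensteinTwistDualityDatum
import Literature.NumberTheory.EllipticCurves.ZpExtensionEisensteinTwistDualityFormReduceProofs
import HarnessLib

/-!
# `SatisfiesH.e_red` for the curve's Eisenstein setting with the H.4 data `eisensteinDualityDatum`: the pairings reduce
# along the tower as soon as the `E`-level forms do (proofs file)

Topic `NumberTheory/EllipticCurves` (D1 road of cell `pub/bsd-print-x9`; companion of `ZpExtensionEisensteinDVRSetting`;
consumer of `ZpExtensionEisensteinTwistDualityDatum` (p637707) and `ZpExtensionEisensteinTwistDualityFormReduceProofs`).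
THEOREMS ONLY; no definition, no named fact, no instance, no notation, no `sorry`.

Howard, §1.6 [arXiv:1202.6340 p. 11, L33–38]: the tower `T^{(k)} = T/π^{e_k}T` carries the INDUCED pairings of H.4, so
`e_k(red x, red y) = e_{k+1}(x, y) mod π^{e_k}` — the field `SatisfiesH.e_red` of `Howard2004.DVRSetting`.  For the
Eisenstein setting of `E_K` with `D k := eisensteinDualityDatum hm (k+1) cd κ E_K[p^{k+1}] ẽ_{k+1} …` (Howard's
`e_𝔮(t₁ ⊗ α₁, t₂ ⊗ α₂) = ι(ẽ(t₁, t₂)) α₁ α₂`, Lemma 2.1.1) built from a family of `ℤ/p^k`-valued forms `ẽ_k` on `E_K[p^k]`: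
* **`WeierstrassCurve.eisensteinDVRSetting_e_red_of`** — if the `E`-level forms are compatible along `E[p^{k+2}] → E[p^{k+1}]`,
  `P ↦ p•P` (`ẽ_{k+1}(pP, pQ) = ẽ_{k+2}(P, Q) mod p^{k+1}` — for the Weil pairings with a compatible system of roots of unity
  this is `e_{p^{k+1}}(pP, pQ) = e_{p^{k+2}}(P, Q)^p`, Silverman III.8.1(e)), then `e_red` holds for the tower:
  `reduce (e_{k+1}(x, y)) = e_k(red x, red y)` (tree `eisensteinDualityForm_reduce`).
This is the `he_red` input of `eisensteinDVRSettingTame_satisfiesH_of` for that `D`.  BSD is not proved by any of this.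

References: [Howard2004HeegnerKolyvagin] §1.6 (arXiv p. 11, L33–38), Lemma 2.1.1, H.4; [SilvermanAEC2009] III.8.1(e).
-/

set_option autoImplicit false

noncomputable section

open Function NumberField IsDedekindDomain Field
open scoped NumberField ContRepresentation TensorProduct Classical

namespace WeierstrassCurve

open Literature.NumberTheory.EllipticCurves Literature.NumberTheory.GaloisRepresentations
open Literature.NumberTheory.GaloisRepresentations.DiscreteGaloisModule
open Literature.NumberTheory.GaloisCohomology.Howard2004
open Literature.NumberTheory.EllipticCurves.ZpExtension (EisensteinLevel eisensteinLevel)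

variable {K : Type} [Field K] [NumberField K] (W : WeierstrassCurve ℚ) [W.IsElliptic] {p : ℕ} [hp : Fact p.Prime]
  (κ : ZpExtension K p) {m : ℕ} (hm : 1 ≤ m) (cd : ConjugationDatum K)
  (eb : ∀ k, geomTorsion (W.baseChange K) ((p : ℤ) ^ k) →+ geomTorsion (W.baseChange K) ((p : ℤ) ^ k) →+ ZMod (p ^ k))
  (hsymm : ∀ k (a b : geomTorsion (W.baseChange K) ((p : ℤ) ^ k)), eb k a b = eb k b a)
  (hequiv : ∀ k (g : absoluteGaloisGroup K) (a b : geomTorsion (W.baseChange K) ((p : ℤ) ^ k)),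
    eb k ((W.baseChange K).torsionGaloisModule ((p : ℤ) ^ k) g a)
      ((W.baseChange K).torsionGaloisModule ((p : ℤ) ^ k) (cd.conj g) b) = cyclotomicCharacterModPow K p k g * eb k a b)
  (hnd : ∀ k (w : geomTorsion (W.baseChange K) ((p : ℤ) ^ k)), (∀ b, eb k w b = 0) → w = 0)
  (hex : ∀ k (φ : geomTorsion (W.baseChange K) ((p : ℤ) ^ k) →+ ZMod (p ^ k)),
    ∃ w : geomTorsion (W.baseChange K) ((p : ℤ) ^ k), ∀ b, eb k w b = φ b)
  (hκ : ∀ k (g : absoluteGaloisGroup K),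
    p ^ eisensteinLevel (p := p) hm k ∣ κ.twistExponent (eisensteinLevel (p := p) hm k) g +
      κ.twistExponent (eisensteinLevel (p := p) hm k) (cd.conj g))

/-- **`SatisfiesH.e_red` for the Eisenstein setting with `D k := eisensteinDualityDatum … ẽ_{k+1} …`**: if the `E`-level
forms reduce along `P ↦ p•P` (`ẽ_{k+1}(pP, pQ) = ẽ_{k+2}(P, Q) mod p^{k+1}`), the pairings of consecutive tower levels are
compatible with the reductions: `reduce (e_{k+1}(x, y)) = e_k(red_k x, red_k y)`.
[cite: Howard2004HeegnerKolyvagin, §1.6 (arXiv p. 11, L33–38) and Lemma 2.1.1] [cite: SilvermanAEC2009, III.8.1(e)] -/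
theorem eisensteinDVRSetting_e_red_of
    (hcompat : ∀ k (a b : geomTorsion (W.baseChange K) ((p : ℤ) ^ (k + 1 + 1))),
      eb (k + 1) ((W.baseChange K).torsionGaloisModuleReduce p (k + 1) a)
          ((W.baseChange K).torsionGaloisModuleReduce p (k + 1) b) =
        ZMod.castHom (pow_dvd_pow p (Nat.le_succ (k + 1))) (ZMod (p ^ (k + 1))) (eb (k + 1 + 1) a b))
    (k : ℕ) (x y : EisensteinLevel p m (fun j ↦ geomTorsion (W.baseChange K) ((p : ℤ) ^ j)) (k + 1 + 1)) :
    letI := IwasawaAlgebra.isLocalRing_quotient_X_pow_add_C p hm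
    IwasawaAlgebra.EisensteinCoeff.reduce p m (Nat.le_succ (k + 1))
        (((fun k ↦ ZpExtension.eisensteinDualityDatum hm (k + 1) cd κ ((W.baseChange K).torsionGaloisModule ((p : ℤ) ^ (k + 1)))
        (eb (k + 1)) (hsymm (k + 1)) (hequiv (k + 1)) (hnd (k + 1)) (hex (k + 1)) (hκ (k + 1))) (k + 1)).e x y) =
      ((fun k ↦ ZpExtension.eisensteinDualityDatum hm (k + 1) cd κ ((W.baseChange K).torsionGaloisModule ((p : ℤ) ^ (k + 1)))
        (eb (k + 1)) (hsymm (k + 1)) (hequiv (k + 1)) (hnd (k + 1)) (hex (k + 1)) (hκ (k + 1))) k).e ((W.eisensteinTower κ hm).red k x) ((W.eisensteinTower κ hm).red k y) := by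
  rw [ZpExtension.eisensteinDualityDatum_e, ZpExtension.eisensteinDualityDatum_e]
  exact (ZpExtension.eisensteinDualityForm_reduce hm (Nat.le_succ (k + 1)) (eb (k + 1)) (eb (k + 1 + 1))
    ((W.baseChange K).torsionGaloisModuleReduce p (k + 1)).toContinuousLinearMap.toLinearMap (hcompat k) x y).symm

end WeierstrassCurve

end
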